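import Literature.AnabelianGeometry.SemiGraphs.TemperedPiVerticialLevelData
import Literature.AnabelianGeometry.SemiGraphs.TemperedVerticialNamedFactsProofs
import Literature.AnabelianGeometry.SemiGraphs.TemperedPiPresentation
import HarnessLib

/-!
# The two data inputs of the subgroup presentation of `π₁^temp(𝒢)` exist: reference branches and
# compatible point sequences over EVERY vertex ([SemiAnbd] §1 p. 11, Thm 3.7 (i) p. 40)

Mochizuki, *Semi-graphs of anabelioids*, Publ. RIMS **42** (2006), §1 p. 11 (a semi-graph: every edge
is a set of branches of cardinality 2, a graph: every branch abuts to a vertex) and §3 Thm 3.7 (i),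
manuscript p. 40 [cite: MochizukiSemiAnbd2006, Thm 3.7 (i) p.40]: "for each vertex `v` of `𝒢`, there is
a natural continuous, injective outer homomorphism `π̂₁(𝒢_v) ↪ π₁^temp(𝒢)`".

PROOF-ONLY file (abc-iut cell, [SemiAnbd] Thm 5.4 producer row T54-B, GAP-LEDGER G-w4d053-1; seat
abc-iut-w4-d029 at abc-iut-L3-d4's request 2026-08-26T04:26:54Z "BINDERS YOU MUST CARRY").  The subgroup
presentation `GaloisLevelData.piPresentation h𝒢 T R` of abc-iut-L3-d4 (`TemperedPiPresentation.lean`) —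
through which the trees of the Galois tower become coset semi-graphs of `π₁^temp(𝒢)` and the ARITHMETIC
action on them is constructed (`TemperedPiTreeCosetIso.lean`, `ArithTreeTower.lean`) — takes two pieces
of DATA:

* `R : SemiGraph.RefBranches 𝒢.graph` — a reference branch of every edge abutting to a vertex; it
  EXISTS for every graph (`SemiGraph.nonempty_refBranches_of_isGraph`: an edge has two branches by the
  semi-graph axiom, and in a graph every branch abuts), the frame of Thm 5.4 ([IUTchI] Rmk 2.5.3 (iii));
* `T : ∀ w, D.PointSeq h𝒢 w` — a compatible sequence of points of the tower `𝒢_{∞,S n}` over every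
  vertex; for abc-iut-L3-t9's tower `D := 𝒢.galoisLevelData h36` of the constructed chart it EXISTS over
  EVERY vertex (`GaloisLevelData.nonempty_pointSeq`, family form `nonempty_pointSeq_family`): by
  Thm 3.7 (i) existence at every vertex (abc-iut-L3-d2's `exists_isVerticialHom`, from Prop 3.2 and
  quasi-coherence + Galois-countability) every vertex carries a verticial homomorphism
  `Π_v → π₁^temp(𝒢)`, and by abc-iut-L3-t8's `exists_pointSeq_of_isVerticialHom` every verticial
  homomorphism is the decomposition homomorphism of a compatible point sequence over `v`.

Consumers (abc-iut-w4-d053's binding of `ArithLevelDataCpt.ofChartEdgeData` to abc-iut-L3-d4's tower)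
obtain the data by `obtain ⟨T⟩ := nonempty_pointSeq_family h36` / `obtain ⟨R⟩ := …`.  Nothing of the
cited files is restated; no definition; nothing here bears on [IUTchIII] Cor. 3.12.
-/

namespace Literature.AnabelianGeometry.SemiGraphs

open CategoryTheory Topology

universe u

namespace SemiGraph

/-- **Reference branches exist for a graph** ([SemiAnbd] §1 p. 11: every edge is a 2-element set of
branches — the semi-graph axiom `two_branches` — and in a GRAPH every branch abuts to a vertex): the
datum `R : RefBranches 𝔾` of abc-iut-L3-d4's `piPresentation`. [cite: MochizukiSemiAnbd2006, §1 p.11] -/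
theorem nonempty_refBranches_of_isGraph (𝔾 : SemiGraph.{u}) (hG : 𝔾.IsGraph) :
    Nonempty (RefBranches 𝔾) := by
  classical
  have hβ : ∀ e : 𝔾.Edge, ∃ b : 𝔾.Branch, 𝔾.edgeOf b = e := fun e => by
    obtain ⟨b₁, -, -, h₁, -⟩ := 𝔾.two_branches e
    exact ⟨b₁, h₁⟩
  choose β hβe using hβ
  have hν : ∀ e : 𝔾.Edge, ∃ v : 𝔾.Vertex, 𝔾.abuts (β e) = some v := fun e =>
    Option.isSome_iff_exists.mp (hG.abuts_isSome (β e))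
  choose ν hνe using hν
  exact ⟨{ β := β, edgeOf_β := hβe, ν := ν, abuts_β := hνe }⟩

end SemiGraph

namespace ProfiniteSemiGraph

variable {𝒢 : ProfiniteSemiGraph.{u}} (h36 : 𝒢.Prop36Hypotheses)

/-- **Compatible point sequences exist over EVERY vertex** of the Galois tower `𝒢_{∞,S n}` of the
constructed chart ([SemiAnbd] Thm 3.7 (i) p. 40: every vertex carries a verticial homomorphism
`Π_v → π₁^temp(𝒢)` — abc-iut-L3-d2's `exists_isVerticialHom` —, and every verticial homomorphism is
the decomposition homomorphism of a compatible point sequence over `v` — abc-iut-L3-t8's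
`exists_pointSeq_of_isVerticialHom`). [cite: MochizukiSemiAnbd2006, Thm 3.7 (i) p.40] -/
theorem GaloisLevelData.nonempty_pointSeq (v : 𝒢.graph.Vertex) :
    Nonempty ((𝒢.galoisLevelData h36).PointSeq h36.isCountable v) := by
  obtain ⟨ψ, hψ⟩ := exists_isVerticialHom h36.isQuasiCoherent h36.isGaloisCountable
    (𝒢.temperedPiChart h36) v
  obtain ⟨P, -⟩ := exists_pointSeq_of_isVerticialHom hψ
  exact ⟨P⟩

/-- **The datum `T : ∀ w, D.PointSeq h𝒢 w` of abc-iut-L3-d4's `piPresentation` exists** for the tower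
of the constructed chart: a compatible point sequence over every vertex, as one family (consume by
`obtain ⟨T⟩ := nonempty_pointSeq_family h36`). [cite: MochizukiSemiAnbd2006, Thm 3.7 (i) p.40] -/
theorem GaloisLevelData.nonempty_pointSeq_family :
    Nonempty (∀ w : 𝒢.graph.Vertex, (𝒢.galoisLevelData h36).PointSeq h36.isCountable w) :=
  ⟨fun w => Classical.choice (GaloisLevelData.nonempty_pointSeq h36 w)⟩

/-- Both data inputs of `piPresentation` at once, for a GRAPH `𝒢` under the Prop 3.6 hypotheses (the
frame of [SemiAnbd] Thm 5.4): reference branches and a compatible point sequence over every vertex.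
[cite: MochizukiSemiAnbd2006, Thm 3.7 (i) p.40] -/
theorem GaloisLevelData.nonempty_presentationInputs (hG : 𝒢.graph.IsGraph) :
    Nonempty ((∀ w : 𝒢.graph.Vertex, (𝒢.galoisLevelData h36).PointSeq h36.isCountable w) ×
      SemiGraph.RefBranches 𝒢.graph) := by
  obtain ⟨T⟩ := GaloisLevelData.nonempty_pointSeq_family h36
  obtain ⟨R⟩ := SemiGraph.nonempty_refBranches_of_isGraph 𝒢.graph hG
  exact ⟨(T, R)⟩

end ProfiniteSemiGraph

end Literature.AnabelianGeometry.SemiGraphs
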